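import Summits.RiemannHypothesis.RiemannHypothesis.Theorems.MotivicDoorSemilocalThreshold
import Summits.RiemannHypothesis.RiemannHypothesis.Theorems.MotivicDoorSemilocalMollifyPolar
import HarnessLib

/-!
# Semi-local threshold `a*({2})` — the certificate → theorem BRIDGES (generic in the certificate)

Cell `rh-explicit` (HOME `run/shared/lean/pub/rh-explicit/`), seat cc-s2-4 (`HOME/cc-s2-4/CC4-LEAN.md` §0.3,
milestone CC-M2 of PLAN §1.3).  Honest framing: theorems about the TREE'S object
`weilSemilocalThreshold {2}` = `a*({2}) := sup {a > 0 : WeilSemilocalPositivityOn {2} a}` (the sharp window of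
positivity of the `{∞, 2}` semi-local Weil form, `MotivicDoorSemilocalThreshold.lean`); no statement about `ζ`,
no RH claim, no data trusted.

The tree proves `a*({2}) ∈ [563/1024, 57/100]` (`weilSemilocalThreshold_two_mem_Icc`) from ONE Stage-C
certificate (`weilCert3C`, `b = 563/1024`) and ONE Markov witness (degree 11, `b = 57/100`), each wired to its
own number.  This file states the two wirings ONCE, GENERICALLY, so that every further verified certificate
closes a NAMED proposition by instantiation and nothing else:

* (B+) `weilSemilocalPositivityOn_two_of_check`: for EVERY Stage-C certificate `c : WeilCert3` with
  `c.check = true` (a `decide +kernel` fact, split over data/row files exactly as `check_weilCert3C`) and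
  `c.b ≤ log 2`: `WeilSemilocalPositivityOn {2} c.b`, hence `c.b ≤ a*({2})`
  (`le_weilSemilocalThreshold_two_of_check`); decidable-hypothesis form `…_of_check_of_le` with
  `c.b ≤ 6931471/10⁷`; transport to every finite `S ∋ 2`, `3 ∉ S`.
* (B−) `weilSemilocalThreshold_two_le_of_markovWitness`: for EVERY Markov witness `G` on `[−b, b]`,
  `b < log 2`, with finite archimedean energy and the certified strict inequality
  `(log 2/√2)·D_{log 2}(G) + ∫₀^∞ w·D(G) < C₂‖G‖² + 2|Ĝ(1)|²` (lad-2's polar-credit criterion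
  `IsMarkovWitness.not_weilSemilocalPositivityOn_two_polar`): `a*({2}) ≤ b`.
* (B±) `weilSemilocalThreshold_two_mem_Icc_of_certificates`: both at once, `a*({2}) ∈ [c.b, b]`.

References: H. Yoshida, Adv. Stud. Pure Math. 21 (1992) Thm 1 p. 310, §6 (the finite certificate method);
A. Connes, Selecta Math. 5 (1999) §VII Thm 4 (semi-local Weil sum); A. Connes, C. Consani, Enseign. Math. 69
(2023) §2.1–2.3 (the semi-local form QW_λ, λ² = 3: only p = 2 enters).
-/

set_option linter.dupNamespace false  -- the mandated namespace repeats `RiemannHypothesis`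

noncomputable section

open MeasureTheory Set Real
open Literature.NumberTheory.LFunctions
open Summit.RiemannHypothesis.RiemannHypothesis.Theorems.MotivicDoor.SemilocalThreshold
open Summit.RiemannHypothesis.RiemannHypothesis.Theorems.MotivicDoor.Semilocal
open Summit.RiemannHypothesis.RiemannHypothesis.Theorems.MotivicDoor.SemilocalMarkov

namespace Summit.RiemannHypothesis.RiemannHypothesis.Theorems.SemilocalCertificateBridge

/-! ## (B+) Positive side: any checked Stage-C certificate -/

/-- **Bridge (B+).** Every Stage-C first-prime certificate `c` whose checker evaluates to `true` and whose
window satisfies `c.b ≤ log 2` proves `{∞,2}`-positivity on `C(c.b)` — the soundness theorem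
`WeilCert3.weilFirstPrimeQuadratic_nonneg_of_check` (`E₂ ≥ 0` on `C(c.b)`) read through
`weilSemilocalPositivityOn_two_iff` (`Q_{{2}} = E₂` on windows `≤ log 2`). [cite: Yoshida1992HermitianForms, Thm. 1 (p. 310), §6 (method)] -/
theorem weilSemilocalPositivityOn_two_of_check {c : WeilCert3} (h : c.check = true)
    (hb : ((c.b : ℚ) : ℝ) ≤ Real.log 2) : WeilSemilocalPositivityOn {2} ((c.b : ℚ) : ℝ) :=
  (weilSemilocalPositivityOn_two_iff hb).2
    fun _ hg hsupp ↦ WeilCert3.weilFirstPrimeQuadratic_nonneg_of_check h hg hsupp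

/-- **Bridge (B+), threshold form**: a checked certificate at `b ≤ log 2` gives `b ≤ a*({2})`. [folklore] -/
theorem le_weilSemilocalThreshold_two_of_check {c : WeilCert3} (h : c.check = true)
    (hb : ((c.b : ℚ) : ℝ) ≤ Real.log 2) : ((c.b : ℚ) : ℝ) ≤ weilSemilocalThreshold {2} :=
  le_weilSemilocalThreshold (weilSemilocalPositivityOn_two_of_check h hb)

/-- `6931471/10⁷ ≤ log 2` (`Real.log_two_gt_d9`). [folklore] -/
theorem ratLogTwoLo_le_log_two : ((6931471 / 10000000 : ℚ) : ℝ) ≤ Real.log 2 := by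
  have h := Real.log_two_gt_d9
  push_cast
  linarith

/-- **Bridge (B+) with a DECIDABLE window condition**: `c.check = true` and `c.b ≤ 6931471/10⁷` (both
`decide`-able on the rational data) give `{∞,2}`-positivity on `C(c.b)`. [folklore] -/
theorem weilSemilocalPositivityOn_two_of_check_of_le {c : WeilCert3} (h : c.check = true)
    (hb : c.b ≤ 6931471 / 10000000) : WeilSemilocalPositivityOn {2} ((c.b : ℚ) : ℝ) :=
  weilSemilocalPositivityOn_two_of_check h
    ((Rat.cast_le.2 hb).trans ratLogTwoLo_le_log_two)

/-- Threshold form of the decidable version: `c.b ≤ a*({2})`. [folklore] -/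
theorem le_weilSemilocalThreshold_two_of_check_of_le {c : WeilCert3} (h : c.check = true)
    (hb : c.b ≤ 6931471 / 10000000) : ((c.b : ℚ) : ℝ) ≤ weilSemilocalThreshold {2} :=
  le_weilSemilocalThreshold (weilSemilocalPositivityOn_two_of_check_of_le h hb)

/-- **Transport of (B+) to every finite set of places `S ∋ 2`, `3 ∉ S`** (on windows `≤ (log 5)/2` the
`S`-form is the `{2}`-form, `weilSemilocalPositivityOn_iff_two`). [folklore] -/
theorem weilSemilocalPositivityOn_of_check {S : Finset ℕ} (h2 : 2 ∈ S) (h3 : 3 ∉ S) {c : WeilCert3}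
    (h : c.check = true) (hb : ((c.b : ℚ) : ℝ) ≤ Real.log 2) :
    WeilSemilocalPositivityOn S ((c.b : ℚ) : ℝ) :=
  (weilSemilocalPositivityOn_iff_two h2 h3 (hb.trans log_two_le_log_five_half)).2
    (weilSemilocalPositivityOn_two_of_check h hb)

/-- Threshold form of the transport: `c.b ≤ a*(S)` for every finite `S ∋ 2`, `3 ∉ S`. [folklore] -/
theorem le_weilSemilocalThreshold_of_check {S : Finset ℕ} (h2 : 2 ∈ S) (h3 : 3 ∉ S) {c : WeilCert3}
    (h : c.check = true) (hb : ((c.b : ℚ) : ℝ) ≤ Real.log 2) :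
    ((c.b : ℚ) : ℝ) ≤ weilSemilocalThreshold S :=
  le_weilSemilocalThreshold (weilSemilocalPositivityOn_of_check h2 h3 h hb)

/-! ## (B−) Negative side: any certified Markov witness (polar credit included) -/

/-- **Bridge (B−).** A Markov witness `G` on `[−b, b]` (`IsMarkovWitness G b M`: bounded, measurable, odd,
a.e. continuous, vanishing off `[−b, b]`), `b < log 2`, with finite archimedean jump energy and the
certified strict inequality `(log 2/√2)·D_{log 2}(G) + ∫₀^∞ w·D(G) < C₂‖G‖₂² + 2|Ĝ(1)|²`, bounds the
threshold from above: `a*({2}) ≤ b` (for every `B ∈ (b, log 2]` the mollified witnesses refute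
positivity on `C(B)`, `IsMarkovWitness.not_weilSemilocalPositivityOn_two_polar`). [folklore] -/
theorem weilSemilocalThreshold_two_le_of_markovWitness {G : ℝ → ℂ} {b M : ℝ}
    (hW : IsMarkovWitness G b M)
    (hfin : IntegrableOn (fun t ↦ weilArchDensity t * weilIncrement G t) (Ioi 0))
    (hlt : Real.log 2 / Real.sqrt 2 * weilIncrement G (Real.log 2) +
        (∫ t in Ioi (0 : ℝ), weilArchDensity t * weilIncrement G t) <
      semilocalTwoConstant * (∫ x, ‖G x‖ ^ 2) + 2 * ‖weilMellin G 1‖ ^ 2)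
    (hb : b < Real.log 2) : weilSemilocalThreshold {2} ≤ b := by
  by_contra h
  have hlt' : b < min (weilSemilocalThreshold {2}) (Real.log 2) := lt_min (lt_of_not_ge h) hb
  exact hW.not_weilSemilocalPositivityOn_two_polar hfin hlt hlt' (min_le_right _ _)
    ((weilSemilocalPositivityOn_weilSemilocalThreshold {2}).mono (min_le_left _ _))

/-- (B−) in failure form: positivity fails on every window `a > b`. [folklore] -/
theorem not_weilSemilocalPositivityOn_two_of_markovWitness {G : ℝ → ℂ} {b M : ℝ}
    (hW : IsMarkovWitness G b M)
    (hfin : IntegrableOn (fun t ↦ weilArchDensity t * weilIncrement G t) (Ioi 0))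
    (hlt : Real.log 2 / Real.sqrt 2 * weilIncrement G (Real.log 2) +
        (∫ t in Ioi (0 : ℝ), weilArchDensity t * weilIncrement G t) <
      semilocalTwoConstant * (∫ x, ‖G x‖ ^ 2) + 2 * ‖weilMellin G 1‖ ^ 2)
    (hb : b < Real.log 2) {a : ℝ} (ha : b < a) : ¬ WeilSemilocalPositivityOn {2} a :=
  not_weilSemilocalPositivityOn_iff_weilSemilocalThreshold_lt.2
    ((weilSemilocalThreshold_two_le_of_markovWitness hW hfin hlt hb).trans_lt ha)

/-- Transport of (B−) to every finite `S ∋ 2`, `3 ∉ S`: `a*(S) ≤ b`. [folklore] -/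
theorem weilSemilocalThreshold_le_of_markovWitness {S : Finset ℕ} (h2 : 2 ∈ S) (h3 : 3 ∉ S)
    {G : ℝ → ℂ} {b M : ℝ} (hW : IsMarkovWitness G b M)
    (hfin : IntegrableOn (fun t ↦ weilArchDensity t * weilIncrement G t) (Ioi 0))
    (hlt : Real.log 2 / Real.sqrt 2 * weilIncrement G (Real.log 2) +
        (∫ t in Ioi (0 : ℝ), weilArchDensity t * weilIncrement G t) <
      semilocalTwoConstant * (∫ x, ‖G x‖ ^ 2) + 2 * ‖weilMellin G 1‖ ^ 2)
    (hb : b < Real.log 2) : weilSemilocalThreshold S ≤ b := by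
  rw [weilSemilocalThreshold_eq_two h2 h3]
  exact weilSemilocalThreshold_two_le_of_markovWitness hW hfin hlt hb

/-! ## (B±) The two-sided theorem shape of CC-M2 -/

/-- **Bridge (B±): the CC-M2 theorem shape.** A checked Stage-C certificate `c` (`c.b ≤ log 2`) and a
certified Markov witness on `[−b, b]` (`b < log 2`) locate the threshold: `a*({2}) ∈ [c.b, b]`.  With
`c = weilCert3C` and lad-2's undecic witness this is the tree's `[563/1024, 57/100]`; every sharper pair
of verified certificates instantiates the same statement. [folklore] -/
theorem weilSemilocalThreshold_two_mem_Icc_of_certificates {c : WeilCert3} (hc : c.check = true)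
    (hcb : ((c.b : ℚ) : ℝ) ≤ Real.log 2) {G : ℝ → ℂ} {b M : ℝ} (hW : IsMarkovWitness G b M)
    (hfin : IntegrableOn (fun t ↦ weilArchDensity t * weilIncrement G t) (Ioi 0))
    (hlt : Real.log 2 / Real.sqrt 2 * weilIncrement G (Real.log 2) +
        (∫ t in Ioi (0 : ℝ), weilArchDensity t * weilIncrement G t) <
      semilocalTwoConstant * (∫ x, ‖G x‖ ^ 2) + 2 * ‖weilMellin G 1‖ ^ 2)
    (hb : b < Real.log 2) :
    weilSemilocalThreshold {2} ∈ Icc (((c.b : ℚ) : ℝ)) b :=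
  ⟨le_weilSemilocalThreshold_two_of_check hc hcb,
    weilSemilocalThreshold_two_le_of_markovWitness hW hfin hlt hb⟩

/-- **Sanity instance of (B+)**: the generic bridge at the tree's certificate `weilCert3C` recovers
`563/1024 ≤ a*({2})` (= `weilSemilocalThreshold_two_mem_Ico.1`). [folklore] -/
theorem certb_le_weilSemilocalThreshold_two : ((weilCert3C.b : ℚ) : ℝ) ≤ weilSemilocalThreshold {2} :=
  le_weilSemilocalThreshold_two_of_check check_weilCert3C certb_le_log_two

end Summit.RiemannHypothesis.RiemannHypothesis.Theorems.SemilocalCertificateBridge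

end
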